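import Summits.PneNP.PneNP.Theorems.OneSliceSliceTargetPairBoundAux
import Summits.PneNP.PneNP.Theorems.OneSliceSliceTargetPairBoundAux2
import Summits.PneNP.PneNP.Theorems.OneSliceConstantBandTransferStepAux

/-!
# Crux `SliceTarget` (stmt-PneNP-2832), line `Sketch-ideator3-r1`: stub B3 `PairBound` — assembly

`stub_pairBound`: on a central slice, for a read set `F` with `2·#F ≤ C(n,2)`, `Σ_Φ a_Φ²/#Φ ≤ (λ² + λ·#F/C(n,2) + ε)·#slice_j`
(`Φ` the fibres of `F`, `a_Φ` = clique graphs in `Φ`, `λ = 1/k!`). Assembles the worker's counting files: `pb_replicaTripleSum`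
(Aux II) and `pb_pairTermCount` (Aux I) give `Σ_Φ ≤ (1 + 4^{K+1}K²/j)·Σ_{A,B} q^{e(A,B)}·#slice_j` with
`e(A,B) = #(K_A ∪ (K_B ∩ F)) + #(K_B ∖ F) ≥ #(K_A ∪ K_B)`, `e(B,B) = K + #(K_B ∖ F)`, hence
`Σ_{A,B} q^{e} ≤ (#F/N)μ + qμ + μ(μ + R(q))`; on the window `μ → λ`, `q, R(q), 1/j → 0`. Lead prover-line-stmt-PneNP-2832-0, 2026-08-16.
-/

set_option linter.dupNamespace false

namespace Summit.PneNP.PneNP.Cruxes.SliceTarget.Ideator3Line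

open Literature.Computability.Complexity Finset Filter Classical
open scoped Topology
open Summit.PneNP.PneNP.Theorems.ConstantBand.Negative (Edge thr Central slice)
open Summit.PneNP.PneNP.Theorems.SliceACZero.Negative (choose_mul_ratio_pow_le')
open Summit.PneNP.PneNP.Cruxes.ConstantBand.FlatPriorRelativeMinterms (ts_tendsto_T ts_T_mul_lower_le ts_le_T_mul_upper
  ts_tendsto_lower ts_tendsto_upper ts_central_iff)

noncomputable section

/-- **The exponent inequality**: `#(K_A ∪ (K_B ∩ F)) + #(K_B ∖ F) ≥ #(K_A ∪ K_B)`. [folklore] -/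
private theorem lpb_exp_ge {n : ℕ} (SA SB F : Finset (Edge n)) :
    #(SA ∪ SB) ≤ #(SA ∪ (SB ∩ F)) + #(SB \ F) := by
  calc #(SA ∪ SB) ≤ #((SA ∪ (SB ∩ F)) ∪ (SB \ F)) := by
        refine card_le_card fun e he => ?_
        rw [Finset.mem_union] at he
        rw [Finset.mem_union, Finset.mem_union, Finset.mem_inter, Finset.mem_sdiff]
        rcases he with h | h
        · exact Or.inl (Or.inl h)
        · by_cases hf : e ∈ F
          · exact Or.inl (Or.inr ⟨h, hf⟩)
          · exact Or.inr ⟨h, hf⟩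
    _ ≤ #(SA ∪ (SB ∩ F)) + #(SB \ F) := card_union_le _ _

/-- **The diagonal exponent**: `#(K_B ∪ (K_B ∩ F)) + #(K_B ∖ F) = #K_B + #(K_B ∖ F)`. [folklore] -/
private theorem lpb_exp_diag {n : ℕ} (SB F : Finset (Edge n)) :
    #(SB ∪ (SB ∩ F)) + #(SB \ F) = #SB + #(SB \ F) := by
  rw [union_eq_left.2 inter_subset_left]

/-- **Overlap sum around a fixed `k`-set** (`q ≥ 0`): `Σ_{A ≠ B} q^{K - C(#(A∩B),2)} ≤ C(n,k)·q^K + R(q)`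
(`#(A ∩ B) ≤ 1`: exponent `K`; else `2 ≤ #(A ∩ B) ≤ k-1`). [folklore] -/
private theorem lpb_sum_pow_le {n k : ℕ} {B : Finset (Fin n)} (hB : B ∈ powersetCard k (univ : Finset (Fin n))) {q : ℝ}
    (hq : 0 ≤ q) :
    ∑ A ∈ (powersetCard k (univ : Finset (Fin n))).filter (fun A => A ≠ B), q ^ (k.choose 2 - (#(A ∩ B)).choose 2) ≤
      (n.choose k : ℝ) * q ^ k.choose 2 +
        ∑ i ∈ Ico 2 k, ((k.choose i * n.choose (k - i) : ℕ) : ℝ) * q ^ (k.choose 2 - i.choose 2) := by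
  -- adapted from Theorems/OneSliceSliceTargetCliqueDensityLower.lean (`cdl_sum_ite_pow_le`)
  set 𝒜 := powersetCard k (univ : Finset (Fin n)) with h𝒜
  have hBk : #B = k := (mem_powersetCard.1 hB).2
  rw [← sum_filter_add_sum_filter_not (𝒜.filter fun A => A ≠ B) (fun A => #(A ∩ B) ≤ 1)]
  refine add_le_add ?_ ?_
  · calc ∑ A ∈ (𝒜.filter fun A => A ≠ B).filter (fun A => #(A ∩ B) ≤ 1), q ^ (k.choose 2 - (#(A ∩ B)).choose 2)
        = ∑ A ∈ (𝒜.filter fun A => A ≠ B).filter (fun A => #(A ∩ B) ≤ 1), q ^ k.choose 2 := by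
          refine sum_congr rfl fun A hA => ?_
          rw [Nat.choose_eq_zero_of_lt (show #(A ∩ B) < 2 by have := (mem_filter.1 hA).2; omega), Nat.sub_zero]
      _ ≤ (#𝒜 : ℝ) * q ^ k.choose 2 := by
          rw [sum_const, nsmul_eq_mul]
          gcongr
          exact (filter_subset _ _).trans (filter_subset _ _)
      _ = (n.choose k : ℝ) * q ^ k.choose 2 := by rw [h𝒜, card_powersetCard, card_univ, Fintype.card_fin]
  · have hmaps : ∀ A ∈ 𝒜.filter (fun A => #(A ∩ B) ∈ Ico 2 k), (fun A => #(A ∩ B)) A ∈ Ico 2 k := fun A hA => (mem_filter.1 hA).2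
    calc ∑ A ∈ (𝒜.filter fun A => A ≠ B).filter (fun A => ¬ #(A ∩ B) ≤ 1), q ^ (k.choose 2 - (#(A ∩ B)).choose 2)
        ≤ ∑ A ∈ 𝒜.filter (fun A => #(A ∩ B) ∈ Ico 2 k), q ^ (k.choose 2 - (#(A ∩ B)).choose 2) := by
          refine sum_le_sum_of_subset_of_nonneg (fun A hA => ?_) (fun _ _ _ => pow_nonneg hq _)
          simp only [mem_filter, mem_Ico] at hA ⊢
          have hlt : #(B ∩ A) < k := pb_card_inter_lt_of_ne hB hA.1.1 (Ne.symm hA.1.2)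
          rw [inter_comm] at hlt
          exact ⟨hA.1.1, by omega, hlt⟩
      _ = ∑ i ∈ Ico 2 k, ∑ A ∈ (𝒜.filter (fun A => #(A ∩ B) ∈ Ico 2 k)).filter (fun A => #(A ∩ B) = i),
            q ^ (k.choose 2 - i.choose 2) := (sum_fiberwise_of_maps_to' hmaps (fun i => q ^ (k.choose 2 - i.choose 2))).symm
      _ ≤ ∑ i ∈ Ico 2 k, ((k.choose i * n.choose (k - i) : ℕ) : ℝ) * q ^ (k.choose 2 - i.choose 2) := by
          refine sum_le_sum fun i _ => ?_
          rw [sum_const, nsmul_eq_mul, filter_filter]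
          refine mul_le_mul_of_nonneg_right ?_ (pow_nonneg hq _)
          have hsub : ((𝒜.filter fun A => #(A ∩ B) ∈ Ico 2 k ∧ #(A ∩ B) = i)) ⊆ 𝒜.filter fun A => #(B ∩ A) = i := by
            intro A hA
            simp only [mem_filter] at hA ⊢
            rw [inter_comm]
            exact ⟨hA.1, hA.2.2⟩
          exact_mod_cast (card_le_card hsub).trans (pb_card_filter_card_inter_eq_le hBk i)

/-- **The deterministic pair bound.** For `k ≥ 2`, `1 ≤ K = C(k,2)`, `4K ≤ j ≤ N = C(n,2)`, `4K ≤ N`, a read set `F` with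
`2·#F ≤ N`, `q = j/N`, `μ = C(n,k) q^K`, `R = Σ_{i=2}^{k-1} C(k,i)C(n,k-i) q^{K-C(i,2)}`:
`Σ_Φ a_Φ²/#Φ ≤ (1 + 4^{K+1}K²/j)·((#F/N)·μ + q·μ + μ·(μ + R))·#slice_j`. [folklore] -/
theorem lpb_pairBound_det {n k j : ℕ} (hk : 2 ≤ k) (F : Finset (Edge n)) (hKN : 4 * k.choose 2 ≤ n.choose 2)
    (hKj : 4 * k.choose 2 ≤ j) (hjN : j ≤ n.choose 2) (h2F : 2 * #F ≤ n.choose 2) :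
    ∑ ρ ∈ (slice n j).image (fun x e => if e ∈ F then x e else false),
        (#((slice n j).filter fun x => (∀ e ∈ F, x e = ρ e) ∧ cliqueFn n k x = true) : ℝ) ^ 2 /
          #((slice n j).filter fun x => ∀ e ∈ F, x e = ρ e) ≤
      (1 + 4 ^ (k.choose 2 + 1) * (k.choose 2 : ℝ) ^ 2 / j) *
        ((#F : ℝ) / (n.choose 2 : ℕ) * ((n.choose k : ℝ) * ((j : ℝ) / (n.choose 2 : ℕ)) ^ k.choose 2) +
          (j : ℝ) / (n.choose 2 : ℕ) * ((n.choose k : ℝ) * ((j : ℝ) / (n.choose 2 : ℕ)) ^ k.choose 2) +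
          ((n.choose k : ℝ) * ((j : ℝ) / (n.choose 2 : ℕ)) ^ k.choose 2) *
            (((n.choose k : ℝ) * ((j : ℝ) / (n.choose 2 : ℕ)) ^ k.choose 2) +
              ∑ i ∈ Ico 2 k, ((k.choose i * n.choose (k - i) : ℕ) : ℝ) *
                ((j : ℝ) / (n.choose 2 : ℕ)) ^ (k.choose 2 - i.choose 2))) * #(slice n j) := by
  set 𝒜 := powersetCard k (univ : Finset (Fin n)) with h𝒜
  set N := n.choose 2 with hNdef
  set K := k.choose 2 with hKdef
  set q : ℝ := (j : ℝ) / (N : ℕ) with hq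
  set S : ℝ := (#(slice n j) : ℝ) with hSdef
  set c : ℝ := 1 + 4 ^ (K + 1) * (K : ℝ) ^ 2 / j with hc
  set Sv : Finset (Fin n) → Finset (Edge n) := fun A => univ.filter fun e : Edge n => cliqueVec A e = true with hSv
  set μ : ℝ := (n.choose k : ℝ) * q ^ K with hμ
  set R : ℝ := ∑ i ∈ Ico 2 k, ((k.choose i * n.choose (k - i) : ℕ) : ℝ) * q ^ (K - i.choose 2) with hR
  have hK1 : 1 ≤ K := by rw [hKdef]; exact Nat.choose_pos hk
  have hN : 0 < N := by omega
  obtain ⟨hNr, hj0⟩ : (0 : ℝ) < (N : ℕ) ∧ (0 : ℝ) < j := ⟨by exact_mod_cast hN, by exact_mod_cast (show 0 < j by omega)⟩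
  have hq0 : 0 ≤ q := div_nonneg (Nat.cast_nonneg _) hNr.le
  have hq1 : q ≤ 1 := by rw [hq, div_le_one hNr]; exact_mod_cast hjN
  have hS0 : 0 ≤ S := Nat.cast_nonneg _
  have hc0 : 0 ≤ c := zero_le_one.trans (by rw [hc]; exact le_add_of_nonneg_right (by positivity))
  have hμ0 : 0 ≤ μ := by positivity
  have hR0 : 0 ≤ R := sum_nonneg fun i _ => mul_nonneg (Nat.cast_nonneg _) (pow_nonneg hq0 _)
  have hSvk : ∀ A ∈ 𝒜, #(Sv A) = K := fun A hA => by rw [hSv, card_filter_cliqueVec, (mem_powersetCard.1 hA).2]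
  have step1 := pb_replicaTripleSum n k j F
  have hterm : ∀ B ∈ 𝒜, ∀ A ∈ 𝒜,
      ∑ x ∈ (slice n j).filter (fun x => ∀ e ∈ Sv A ∪ (Sv B ∩ F), x e = true),
          (((#(onSet x \ F)).choose #(Sv B \ F) : ℕ) : ℝ) / ((#Fᶜ).choose #(Sv B \ F) : ℕ) ≤
        c * q ^ (#(Sv A ∪ (Sv B ∩ F)) + #(Sv B \ F)) * S := by
    intro B hB A hA
    have htK : #(Sv B \ F) ≤ K := (card_le_card sdiff_subset).trans (hSvk B hB).le
    have hD : #(Sv A ∪ (Sv B ∩ F)) ≤ 2 * K := by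
      calc #(Sv A ∪ (Sv B ∩ F)) ≤ #(Sv A) + #(Sv B ∩ F) := card_union_le _ _
        _ ≤ K + K := add_le_add (hSvk A hA).le ((card_le_card inter_subset_left).trans (hSvk B hB).le)
        _ = 2 * K := by ring
    exact pb_pairTermCount n j K _ F _ htK hD hK1 hKN hKj hjN h2F
  have hexp : ∀ B ∈ 𝒜, ∀ A ∈ 𝒜, q ^ (#(Sv A ∪ (Sv B ∩ F)) + #(Sv B \ F)) ≤
      (if A ≠ B then q ^ K * q ^ (K - (#(A ∩ B)).choose 2) else q ^ K * (if #(Sv B \ F) = 0 then 1 else q)) := by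
    intro B hB A hA
    by_cases hAB : A ≠ B
    · rw [if_pos hAB, ← pow_add]
      refine pow_le_pow_of_le_one hq0 hq1 ?_
      have hunion : #(Sv A ∪ Sv B) + (#(A ∩ B)).choose 2 = K + K := by
        have h := pb_card_cliqueEdges_union_add (n := n) A B
        rw [(mem_powersetCard.1 hA).2, (mem_powersetCard.1 hB).2] at h
        exact h
      have h1 := lpb_exp_ge (Sv A) (Sv B) F
      have hg : (#(A ∩ B)).choose 2 ≤ K := by
        rw [hKdef]
        exact Nat.choose_le_choose 2 ((card_le_card inter_subset_left).trans (mem_powersetCard.1 hA).2.le)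
      omega
    · rw [if_neg hAB]
      push Not at hAB
      subst hAB
      rw [lpb_exp_diag, hSvk A hA, pow_add]
      refine mul_le_mul_of_nonneg_left ?_ (pow_nonneg hq0 _)
      by_cases ht : #(Sv A \ F) = 0
      · rw [if_pos ht, ht, pow_zero]
      · rw [if_neg ht]
        calc q ^ #(Sv A \ F) ≤ q ^ 1 := pow_le_pow_of_le_one hq0 hq1 (Nat.one_le_iff_ne_zero.2 ht)
          _ = q := pow_one q
  have hinner : ∀ B ∈ 𝒜, ∑ A ∈ 𝒜, q ^ (#(Sv A ∪ (Sv B ∩ F)) + #(Sv B \ F)) ≤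
      q ^ K * (if #(Sv B \ F) = 0 then 1 else q) + q ^ K * (μ + R) := by
    intro B hB
    calc ∑ A ∈ 𝒜, q ^ (#(Sv A ∪ (Sv B ∩ F)) + #(Sv B \ F))
        ≤ ∑ A ∈ 𝒜, (if A ≠ B then q ^ K * q ^ (K - (#(A ∩ B)).choose 2)
            else q ^ K * (if #(Sv B \ F) = 0 then 1 else q)) := sum_le_sum (hexp B hB)
      _ = ∑ A ∈ 𝒜.filter (fun A => A ≠ B), q ^ K * q ^ (K - (#(A ∩ B)).choose 2) +
          ∑ A ∈ 𝒜.filter (fun A => ¬ A ≠ B), q ^ K * (if #(Sv B \ F) = 0 then 1 else q) := by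
          rw [← sum_filter_add_sum_filter_not 𝒜 (fun A => A ≠ B)]
          congr 1
          · exact sum_congr rfl fun A hA => if_pos (mem_filter.1 hA).2
          · exact sum_congr rfl fun A hA => if_neg (mem_filter.1 hA).2
      _ ≤ q ^ K * (μ + R) + q ^ K * (if #(Sv B \ F) = 0 then 1 else q) := by
          refine add_le_add ?_ ?_
          · rw [← mul_sum]
            exact mul_le_mul_of_nonneg_left (lpb_sum_pow_le hB hq0) (pow_nonneg hq0 _)
          · have hfil : 𝒜.filter (fun A => ¬ A ≠ B) = {B} := by
              ext A
              simp only [mem_filter, mem_singleton, not_not]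
              exact ⟨fun h => h.2, fun h => ⟨h ▸ hB, h⟩⟩
            rw [hfil, sum_singleton]
      _ = _ := by ring
  have hdiag : ∑ B ∈ 𝒜, q ^ K * (if #(Sv B \ F) = 0 then (1 : ℝ) else q) ≤ (#F : ℝ) / (N : ℕ) * μ + q * μ := by
    have hsplit : ∑ B ∈ 𝒜, q ^ K * (if #(Sv B \ F) = 0 then (1 : ℝ) else q) =
        q ^ K * #(𝒜.filter fun B => #(Sv B \ F) = 0) + q ^ K * q * #(𝒜.filter fun B => ¬ #(Sv B \ F) = 0) := by
      rw [← sum_filter_add_sum_filter_not 𝒜 (fun B => #(Sv B \ F) = 0)]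
      have e1 : ∑ B ∈ 𝒜.filter (fun B => #(Sv B \ F) = 0), q ^ K * (if #(Sv B \ F) = 0 then (1 : ℝ) else q) =
          ∑ B ∈ 𝒜.filter (fun B => #(Sv B \ F) = 0), q ^ K :=
        sum_congr rfl fun B hB => by rw [if_pos (mem_filter.1 hB).2, mul_one]
      have e2 : ∑ B ∈ 𝒜.filter (fun B => ¬ #(Sv B \ F) = 0), q ^ K * (if #(Sv B \ F) = 0 then (1 : ℝ) else q) =
          ∑ B ∈ 𝒜.filter (fun B => ¬ #(Sv B \ F) = 0), q ^ K * q :=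
        sum_congr rfl fun B hB => by rw [if_neg (mem_filter.1 hB).2]
      rw [e1, e2, sum_const, sum_const, nsmul_eq_mul, nsmul_eq_mul]
      ring
    rw [hsplit]
    have hF' : #F ≤ N := by omega
    have hcount := pb_card_filter_cliqueEdges_subset_mul_le hk F hF'
    have hcount' : (#(𝒜.filter fun B => #(Sv B \ F) = 0) : ℝ) ≤ (#F : ℝ) / (N : ℕ) * (n.choose k : ℝ) := by
      rw [div_mul_eq_mul_div, le_div_iff₀ hNr]
      have : ((N * #(𝒜.filter fun B => #(Sv B \ F) = 0) : ℕ) : ℝ) ≤ ((#F * n.choose k : ℕ) : ℝ) := by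
        exact_mod_cast hcount
      push_cast at this
      linarith
    have hrest : (#(𝒜.filter fun B => ¬ #(Sv B \ F) = 0) : ℝ) ≤ (n.choose k : ℝ) := by
      have h : #(𝒜.filter fun B => ¬ #(Sv B \ F) = 0) ≤ #𝒜 := card_le_card (filter_subset _ _)
      rw [h𝒜, card_powersetCard, card_univ, Fintype.card_fin] at h
      exact_mod_cast h
    have hqK : 0 ≤ q ^ K := pow_nonneg hq0 _
    calc q ^ K * (#(𝒜.filter fun B => #(Sv B \ F) = 0) : ℝ) + q ^ K * q * #(𝒜.filter fun B => ¬ #(Sv B \ F) = 0)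
        ≤ q ^ K * ((#F : ℝ) / (N : ℕ) * (n.choose k : ℝ)) + q ^ K * q * (n.choose k : ℝ) :=
          add_le_add (mul_le_mul_of_nonneg_left hcount' hqK) (mul_le_mul_of_nonneg_left hrest (mul_nonneg hqK hq0))
      _ = (#F : ℝ) / (N : ℕ) * μ + q * μ := by rw [hμ]; ring
  have houter : ∑ B ∈ 𝒜, ∑ A ∈ 𝒜, q ^ (#(Sv A ∪ (Sv B ∩ F)) + #(Sv B \ F)) ≤
      (#F : ℝ) / (N : ℕ) * μ + q * μ + μ * (μ + R) := by
    calc ∑ B ∈ 𝒜, ∑ A ∈ 𝒜, q ^ (#(Sv A ∪ (Sv B ∩ F)) + #(Sv B \ F))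
        ≤ ∑ B ∈ 𝒜, (q ^ K * (if #(Sv B \ F) = 0 then 1 else q) + q ^ K * (μ + R)) := sum_le_sum hinner
      _ = ∑ B ∈ 𝒜, q ^ K * (if #(Sv B \ F) = 0 then (1 : ℝ) else q) + (#𝒜 : ℝ) * (q ^ K * (μ + R)) := by
          rw [sum_add_distrib, sum_const, nsmul_eq_mul]
      _ ≤ (#F : ℝ) / (N : ℕ) * μ + q * μ + (n.choose k : ℝ) * (q ^ K * (μ + R)) := by
          rw [h𝒜, card_powersetCard, card_univ, Fintype.card_fin]
          linarith [hdiag]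
      _ = _ := by rw [hμ]; ring
  calc _ ≤ _ := step1
    _ ≤ ∑ B ∈ 𝒜, ∑ A ∈ 𝒜, c * q ^ (#(Sv A ∪ (Sv B ∩ F)) + #(Sv B \ F)) * S :=
        sum_le_sum fun B hB => sum_le_sum fun A hA => hterm B hB A hA
    _ = c * (∑ B ∈ 𝒜, ∑ A ∈ 𝒜, q ^ (#(Sv A ∪ (Sv B ∩ F)) + #(Sv B \ F))) * S := by
        rw [mul_sum, sum_mul]
        refine sum_congr rfl fun B _ => ?_
        rw [mul_sum, sum_mul]
    _ ≤ c * ((#F : ℝ) / (N : ℕ) * μ + q * μ + μ * (μ + R)) * S :=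
        mul_le_mul_of_nonneg_right (mul_le_mul_of_nonneg_left houter hc0) hS0

/-- **B3 `PairBound`** (registered statement of line `Sketch-ideator3-r1`, crux stmt-PneNP-2832): for `k ≥ 3` and `ε > 0`,
eventually in `n`, on every central slice `j`, for every read set `F` with `2·#F ≤ C(n,2)`:
`Σ_Φ a_Φ²/#Φ ≤ ((1/k!)² + (1/k!)·#F/C(n,2) + ε)·#slice_j`. [folklore] -/
theorem stub_pairBound :
    ∀ k : ℕ, 3 ≤ k → ∀ ε : ℝ, 0 < ε → ∀ᶠ n : ℕ in atTop, ∀ j : ℕ, Central k n j →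
      ∀ F : Finset (Edge n), 2 * #F ≤ n.choose 2 →
        ∑ ρ ∈ (slice n j).image (fun x e => if e ∈ F then x e else false),
            (#((slice n j).filter fun x => (∀ e ∈ F, x e = ρ e) ∧ cliqueFn n k x = true) : ℝ) ^ 2 /
              #((slice n j).filter fun x => ∀ e ∈ F, x e = ρ e) ≤
          ((1 / (k.factorial : ℝ)) ^ 2 + 1 / (k.factorial : ℝ) * (#F / (n.choose 2 : ℕ)) + ε) * #(slice n j) := by
  intro k hk ε hε
  obtain ⟨hk2, hk1r⟩ : 2 ≤ k ∧ (1 : ℝ) < k := ⟨by omega, by exact_mod_cast (show 1 < k by omega)⟩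
  set lam : ℝ := 1 / (k.factorial : ℝ) with hlam
  have hlam0 : 0 < lam := by positivity
  obtain ⟨p, hp⟩ : ∃ p : ℕ → ℝ, ∀ n : ℕ, p n = (n : ℝ) ^ (-(2 : ℝ) / ((k : ℝ) - 1)) := ⟨_, fun _ => rfl⟩
  obtain ⟨T, hT⟩ : ∃ T : ℕ → ℝ, ∀ n : ℕ, T n = ((n.choose 2 : ℕ) : ℝ) * p n := ⟨_, fun _ => rfl⟩
  obtain ⟨up, hup⟩ : ∃ up : ℕ → ℝ, ∀ n : ℕ, up n = 1 + (T n) ^ (-(1 / 4 : ℝ)) + ((0 : ℕ) : ℝ) / T n := ⟨_, fun _ => rfl⟩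
  obtain ⟨R, hR⟩ : ∃ R : ℕ → ℝ, ∀ n : ℕ, R n = ∑ i ∈ Ico 2 k, ((k.choose i * n.choose (k - i) : ℕ) : ℝ) * (2 * p n) ^ (k.choose 2 - i.choose 2) := ⟨_, fun _ => rfl⟩
  obtain ⟨cc, hcc⟩ : ∃ cc : ℕ → ℝ, ∀ n : ℕ, cc n = 1 + 4 ^ (k.choose 2 + 1) * (k.choose 2 : ℝ) ^ 2 * (2 / T n) := ⟨_, fun _ => rfl⟩
  have hp0 : ∀ n : ℕ, 0 ≤ p n := fun n => by rw [hp n]; exact Real.rpow_nonneg (Nat.cast_nonneg _) _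
  have hplim : Tendsto p atTop (𝓝 0) := (tendsto_rpow_threshold hk2).congr fun n => (hp n).symm
  have hTlim : Tendsto T atTop atTop := (ts_tendsto_T hk).congr fun n => by rw [hT n, hp n]
  have huplim : Tendsto up atTop (𝓝 1) := (ts_tendsto_upper hTlim 0).congr fun n => (hup n).symm
  have hcclim : Tendsto cc atTop (𝓝 1) := by
    have h := (tendsto_const_nhds (x := (1 : ℝ))).add ((tendsto_const_nhds (x := (4 : ℝ) ^ (k.choose 2 + 1) *
      (k.choose 2 : ℝ) ^ 2)).mul ((tendsto_const_nhds (x := (2 : ℝ))).div_atTop hTlim))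
    rw [mul_zero, add_zero] at h
    exact h.congr fun n => (hcc n).symm
  have hRlim : Tendsto R atTop (𝓝 0) := by
    have hterm : ∀ i ∈ Ico 2 k, Tendsto (fun n : ℕ =>
        ((k.choose i * n.choose (k - i) : ℕ) : ℝ) * (2 * p n) ^ (k.choose 2 - i.choose 2)) atTop (𝓝 0) := by
      intro i hi
      rw [mem_Ico] at hi
      have hiK : i.choose 2 ≤ k.choose 2 := Nat.choose_le_choose 2 hi.2.le
      have hexp : ((k - i : ℕ) : ℝ) + -(2 : ℝ) / ((k : ℝ) - 1) * ((k.choose 2 - i.choose 2 : ℕ) : ℝ) =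
          -((i : ℝ) * ((k : ℝ) - i) / ((k : ℝ) - 1)) := by
        have hk1' : (k : ℝ) - 1 ≠ 0 := by linarith
        rw [Nat.cast_sub hiK, Nat.cast_choose_two, Nat.cast_choose_two, Nat.cast_sub hi.2.le]
        field_simp; ring
      obtain ⟨hi2, hik⟩ : (2 : ℝ) ≤ i ∧ (i : ℝ) < k := ⟨by exact_mod_cast hi.1, by exact_mod_cast hi.2⟩
      have hneg : 0 < (i : ℝ) * ((k : ℝ) - i) / ((k : ℝ) - 1) := div_pos (mul_pos (by linarith) (by linarith)) (by linarith)
      have hlim' := ((tendsto_rpow_neg_atTop hneg).comp tendsto_natCast_atTop_atTop).const_mul ((k.choose i : ℝ) * 2 ^ (k.choose 2 - i.choose 2))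
      rw [mul_zero] at hlim'
      refine squeeze_zero' (Eventually.of_forall fun n => mul_nonneg (Nat.cast_nonneg _) (pow_nonneg (mul_nonneg zero_le_two (hp0 n)) _)) ?_ hlim'
      filter_upwards [eventually_ge_atTop 1] with n hn1
      have hn0 : (0 : ℝ) < n := by exact_mod_cast hn1
      have h1 : ((k.choose i * n.choose (k - i) : ℕ) : ℝ) ≤ (k.choose i : ℝ) * (n : ℝ) ^ ((k - i : ℕ) : ℝ) := by
        rw [Real.rpow_natCast]; push_cast
        exact mul_le_mul_of_nonneg_left (by exact_mod_cast Nat.choose_le_pow n (k - i)) (Nat.cast_nonneg _)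
      calc ((k.choose i * n.choose (k - i) : ℕ) : ℝ) * (2 * p n) ^ (k.choose 2 - i.choose 2)
          ≤ (k.choose i : ℝ) * (n : ℝ) ^ ((k - i : ℕ) : ℝ) *
              (2 ^ (k.choose 2 - i.choose 2) * ((n : ℝ) ^ (-(2 : ℝ) / ((k : ℝ) - 1))) ^ (k.choose 2 - i.choose 2)) := by
            rw [mul_pow, hp n]
            exact mul_le_mul_of_nonneg_right h1 (by positivity)
        _ = (k.choose i : ℝ) * 2 ^ (k.choose 2 - i.choose 2) * (n : ℝ) ^ (-((i : ℝ) * ((k : ℝ) - i) / ((k : ℝ) - 1))) := by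
            rw [← Real.rpow_mul_natCast hn0.le, ← hexp, Real.rpow_add hn0]
            ring
    have hsum := tendsto_finsetSum (Ico 2 k) hterm
    rw [sum_const_zero] at hsum
    exact hsum.congr fun n => (hR n).symm
  have hmlim : Tendsto (fun n : ℕ => up n ^ k.choose 2 / (k.factorial : ℝ)) atTop (𝓝 lam) := by
    have h := (huplim.pow (k.choose 2)).div_const (k.factorial : ℝ)
    simpa only [one_pow, hlam] using h
  have hHlim : Tendsto (fun n : ℕ => |cc n * (up n ^ k.choose 2 / (k.factorial : ℝ)) - lam| / 2 + cc n * (2 * p n *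
      (up n ^ k.choose 2 / (k.factorial : ℝ)) + (up n ^ k.choose 2 / (k.factorial : ℝ)) * ((up n ^ k.choose 2 /
        (k.factorial : ℝ)) + R n)) - lam ^ 2) atTop (𝓝 0) := by
    have h1 : Tendsto (fun n : ℕ => |cc n * (up n ^ k.choose 2 / (k.factorial : ℝ)) - lam| / 2) atTop (𝓝 0) := by
      have h := ((hcclim.mul hmlim).sub (tendsto_const_nhds (x := lam))).abs.div_const 2
      simpa using h
    have h2 : Tendsto (fun n : ℕ => cc n * (2 * p n * (up n ^ k.choose 2 / (k.factorial : ℝ)) +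
        (up n ^ k.choose 2 / (k.factorial : ℝ)) * ((up n ^ k.choose 2 / (k.factorial : ℝ)) + R n)) - lam ^ 2)
        atTop (𝓝 0) := by
      have h := (hcclim.mul ((((tendsto_const_nhds (x := (2 : ℝ))).mul hplim).mul hmlim).add
        (hmlim.mul (hmlim.add hRlim)))).sub (tendsto_const_nhds (x := lam ^ 2))
      have hval : (1 : ℝ) * (2 * 0 * lam + lam * (lam + 0)) - lam ^ 2 = 0 := by ring
      rw [hval] at h
      exact h
    have h := h1.add h2
    rw [add_zero] at h
    simpa only [add_sub_assoc] using h
  have eH := (tendsto_order.1 hHlim).2 ε hε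
  have eup : ∀ᶠ n : ℕ in atTop, up n < 2 := (tendsto_order.1 huplim).2 _ (by norm_num)
  have ep : ∀ᶠ n : ℕ in atTop, p n < 1 / 2 := (tendsto_order.1 hplim).2 _ (by norm_num)
  have elow : ∀ᶠ n : ℕ in atTop, (1 / 2 : ℝ) < 1 - (T n) ^ (-(1 / 4 : ℝ)) - 1 / T n :=
    (tendsto_order.1 (ts_tendsto_lower hTlim)).1 _ (by norm_num)
  filter_upwards [eH, eup, ep, elow, hTlim.eventually_ge_atTop (8 * (k.choose 2 : ℝ) + 2), eventually_ge_atTop k] with n hHn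
    hupn hpn hlown hTn hkn j hj F h2F
  obtain ⟨hK0, hn1⟩ : (0 : ℝ) ≤ k.choose 2 ∧ 1 ≤ n := ⟨Nat.cast_nonneg _, by omega⟩
  have hN : 0 < n.choose 2 := Nat.choose_pos (by omega)
  obtain ⟨hNr, hT0⟩ : (0 : ℝ) < (n.choose 2 : ℕ) ∧ 0 < T n := ⟨by exact_mod_cast hN, by linarith⟩
  have hup0 : 0 ≤ up n := by rw [hup n, Nat.cast_zero, zero_div, add_zero]; exact add_nonneg zero_le_one (Real.rpow_nonneg hT0.le _)
  have hj' : |(j : ℝ) - (⌊T n⌋₊ : ℝ)| ≤ (⌊T n⌋₊ : ℝ) ^ ((3 : ℝ) / 4) := by have h := ts_central_iff.1 hj; rwa [← hp n, ← hT n] at h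
  have hjup : (j : ℝ) ≤ T n * up n := by rw [hup n]; exact ts_le_T_mul_upper hT0 hj' (Nat.le_add_right j 0)
  have hjlo : T n / 2 ≤ j := by
    have h := ts_T_mul_lower_le hT0 hj'
    have h2 : T n / 2 ≤ T n * (1 - T n ^ (-(1 / 4 : ℝ)) - 1 / T n) := by nlinarith only [hT0, hlown]
    linarith only [h, h2]
  have hjN : j ≤ n.choose 2 := by
    have h : p n * up n ≤ 1 := by nlinarith [hp0 n]
    have : (j : ℝ) ≤ (n.choose 2 : ℕ) := hjup.trans (by rw [hT n, mul_assoc]; exact mul_le_of_le_one_right hNr.le h)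
    exact_mod_cast this
  have hKj : 4 * k.choose 2 ≤ j := by
    have : 4 * (k.choose 2 : ℝ) ≤ j := by linarith
    exact_mod_cast this
  have hKN : 4 * k.choose 2 ≤ n.choose 2 := hKj.trans hjN
  have hj0 : (0 : ℝ) < j := by linarith
  set q : ℝ := (j : ℝ) / (n.choose 2 : ℕ) with hqdef
  set μ : ℝ := (n.choose k : ℝ) * q ^ k.choose 2 with hμdef
  set Rq : ℝ := ∑ i ∈ Ico 2 k, ((k.choose i * n.choose (k - i) : ℕ) : ℝ) * q ^ (k.choose 2 - i.choose 2) with hRqdef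
  set f : ℝ := (#F : ℝ) / (n.choose 2 : ℕ) with hfdef
  have hdet : _ ≤ (1 + 4 ^ (k.choose 2 + 1) * (k.choose 2 : ℝ) ^ 2 / j) * (f * μ + q * μ + μ * (μ + Rq)) * #(slice n j) :=
    lpb_pairBound_det hk2 F hKN hKj hjN h2F
  have hq0 : 0 ≤ q := div_nonneg (Nat.cast_nonneg _) hNr.le
  have hqp : q ≤ 2 * p n := by
    rw [hqdef, div_le_iff₀ hNr]
    exact hjup.trans (by rw [hT n]; nlinarith [mul_nonneg hNr.le (hp0 n)])
  have hμ : μ ≤ up n ^ k.choose 2 / (k.factorial : ℝ) :=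
    choose_mul_ratio_pow_le' hk2 hn1 hN (by rw [← hp n, ← hT n]; exact hjup)
  have hRq : Rq ≤ R n := by
    rw [hR n]
    exact sum_le_sum fun i _ => mul_le_mul_of_nonneg_left (pow_le_pow_left₀ hq0 hqp _) (Nat.cast_nonneg _)
  obtain ⟨hμ0, hR0⟩ : 0 ≤ μ ∧ 0 ≤ Rq := ⟨by positivity, sum_nonneg fun i _ => mul_nonneg (Nat.cast_nonneg _) (pow_nonneg hq0 _)⟩
  have hm0 : 0 ≤ up n ^ k.choose 2 / (k.factorial : ℝ) := div_nonneg (pow_nonneg hup0 _) (Nat.cast_nonneg _)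
  have hcj : 1 + 4 ^ (k.choose 2 + 1) * (k.choose 2 : ℝ) ^ 2 / j ≤ cc n := by
    have h1 : (1 : ℝ) / j ≤ 2 / T n := by rw [div_le_div_iff₀ hj0 hT0]; linarith
    rw [hcc n, show 4 ^ (k.choose 2 + 1) * (k.choose 2 : ℝ) ^ 2 / j = 4 ^ (k.choose 2 + 1) * (k.choose 2 : ℝ) ^ 2 * (1 / j)
      by ring]
    exact add_le_add_right (mul_le_mul_of_nonneg_left h1
      (by positivity : (0 : ℝ) ≤ 4 ^ (k.choose 2 + 1) * (k.choose 2 : ℝ) ^ 2)) 1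
  have hcc0 : 0 ≤ cc n := le_trans (by positivity) hcj
  obtain ⟨hS0, hf0⟩ : (0 : ℝ) ≤ #(slice n j) ∧ 0 ≤ f := ⟨Nat.cast_nonneg _, by positivity⟩
  have hf : f ≤ 1 / 2 := by
    rw [hfdef, div_le_iff₀ hNr]
    have : (2 * #F : ℝ) ≤ (n.choose 2 : ℕ) := by exact_mod_cast h2F
    linarith only [this]
  have hin : f * μ + q * μ + μ * (μ + Rq) ≤ f * (up n ^ k.choose 2 / (k.factorial : ℝ)) +
      2 * p n * (up n ^ k.choose 2 / (k.factorial : ℝ)) +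
      (up n ^ k.choose 2 / (k.factorial : ℝ)) * ((up n ^ k.choose 2 / (k.factorial : ℝ)) + R n) := by
    have h1 := mul_le_mul_of_nonneg_left hμ hf0
    have h2 : q * μ ≤ 2 * p n * (up n ^ k.choose 2 / (k.factorial : ℝ)) :=
      mul_le_mul hqp hμ hμ0 (by linarith only [hp0 n])
    have h3 : μ * (μ + Rq) ≤ (up n ^ k.choose 2 / (k.factorial : ℝ)) * ((up n ^ k.choose 2 / (k.factorial : ℝ)) + R n) :=
      mul_le_mul hμ (add_le_add hμ hRq) (add_nonneg hμ0 hR0) hm0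
    linarith only [h1, h2, h3]
  have hbr := mul_le_mul hcj hin (add_nonneg (add_nonneg (mul_nonneg hf0 hμ0) (mul_nonneg hq0 hμ0))
    (mul_nonneg hμ0 (add_nonneg hμ0 hR0))) hcc0
  have habs : (cc n * (up n ^ k.choose 2 / (k.factorial : ℝ)) - lam) * f ≤
      |cc n * (up n ^ k.choose 2 / (k.factorial : ℝ)) - lam| / 2 := by
    calc (cc n * (up n ^ k.choose 2 / (k.factorial : ℝ)) - lam) * f
        ≤ |cc n * (up n ^ k.choose 2 / (k.factorial : ℝ)) - lam| * f := mul_le_mul_of_nonneg_right (le_abs_self _) hf0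
      _ ≤ |cc n * (up n ^ k.choose 2 / (k.factorial : ℝ)) - lam| * (1 / 2) := mul_le_mul_of_nonneg_left hf (abs_nonneg _)
      _ = _ := by ring
  have hfin : cc n * (f * (up n ^ k.choose 2 / (k.factorial : ℝ)) + 2 * p n * (up n ^ k.choose 2 / (k.factorial : ℝ)) +
      (up n ^ k.choose 2 / (k.factorial : ℝ)) * ((up n ^ k.choose 2 / (k.factorial : ℝ)) + R n)) ≤
      lam ^ 2 + lam * f + ε := by
    rw [show cc n * (f * (up n ^ k.choose 2 / (k.factorial : ℝ)) + 2 * p n * (up n ^ k.choose 2 / (k.factorial : ℝ)) +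
        (up n ^ k.choose 2 / (k.factorial : ℝ)) * ((up n ^ k.choose 2 / (k.factorial : ℝ)) + R n)) =
        (cc n * (up n ^ k.choose 2 / (k.factorial : ℝ)) - lam) * f + lam * f + cc n * (2 * p n *
          (up n ^ k.choose 2 / (k.factorial : ℝ)) + (up n ^ k.choose 2 / (k.factorial : ℝ)) *
            ((up n ^ k.choose 2 / (k.factorial : ℝ)) + R n)) by ring]
    linarith only [hHn, habs]
  have hkey := hdet.trans (mul_le_mul_of_nonneg_right (hbr.trans hfin) hS0)
  rwa [hlam] at hkey

end

end Summit.PneNP.PneNP.Cruxes.SliceTarget.Ideator3Line
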